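import Summits.ResolutionOfSingularities.ResolutionOfSingularities.Theorems.PurelyInseparableDim4InScopeWinCertFast
import Summits.ResolutionOfSingularities.ResolutionOfSingularities.Theorems.PurelyInseparableDim4InScopeWinCertF
import HarnessLib
import HarnessLib.Audit.Tags

/-!
# Purely inseparable fourfolds — IN-SCOPE WIN CERTIFICATES: the FAST checker with F-KEYED child look-up (`iwinCertHBLF`)
# [OURS · counted 0 · a certificate format for OUR frame v4, not about resolution]

Census cell «res-dim4-pi» (D-0157 DOOR 2), width seat `res-dim4-p-10` (g4).  The two landed refinements of res-dim4-p-14's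
in-scope certificate checker are combined:

* res-dim4-p-14 g3's FAST checker (`…InScopeWinCertFast`: the Hasse–Taylor equimultiplicity test `equiHB` in place of the
  expansion test `equiB`; `iwinCertHB`, `iwinCertHBL`), and
* res-dim4-p-13 g2's F-KEYED look-up (`…InScopeWinCertF`: a child is cited by its POLYNOMIAL only — the in-scope attractor
  does not read the books `r`, `exc`, `FlatAbsorb.inScopeStateWins_congr`; `iwinCertBLF`).

Here: `ireplyHOKF` / `irowHOKF` / **`iwinCertHBLF q L T`** (fast test AND F-keyed citation, external leaves `L`), the
reduction `iwinCertBLF_of_iwinCertHBLF` (row by row, `ireplyOKF_of_ireplyHOKF`, exactly as p-14's `iwinCertBL_of_iwinCertHBL`),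
and the soundness **`inScopeStateWins_of_iwinCertHBLF`**: `(∀ s ∈ L, InScopeStateWins q s.toState) → iwinCertHBLF q L T = true →
∀ row ∈ T, InScopeStateWins q row.1.toState`.  WHY: the unit-leaf in-scope certificates (`…PureLeafUnitInScope<a>`) meet the
same polynomial with 2–3 different books along B's along-centre translations (1428 presented states for 435 polynomials
on the leaf 3333); F-keyed citation divides their length by that factor.  Acceptance: p-14's model `scopeLossCert` passes
(`iwinCertHBLF_scopeLossCert`).

Riders: `K`-rational replies over the finite `K` of the certificate (NOT ∀K); a statement about OUR frame-v4 game; nothing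
here proves F4-C(2,2) or resolution of singularities in dimension ≥ 4 / characteristic `p`; counted 0; AI kernel work,
weaker than expert review. bears_on: LADDER-RESOLUTION:D157-DOOR2 (res-dim4-pi · F4-C instrument · certificate format).
Supports stmt-ResolutionOfSingularities-16155 (helper).
-/

set_option linter.dupNamespace false

noncomputable section

namespace Summit.ResolutionOfSingularities.ResolutionOfSingularities.Theorems.PIDim4

namespace InScopeWinCert

open Literature.AlgebraicGeometry.Resolution
open StepKit WinCertSound ScopeBlind

variable {K : Type} [Field K] [DecidableEq K] [Fintype K]

/-! ## 1. The fast F-keyed checker -/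

/-- B's reply `(j, b)` is harmless (fast, F-keyed): rejected by the Hasse–Taylor test, or kills `F`, or its polynomial
is certified later. [folklore] -/
def ireplyHOKF (q : ℕ) (rest : ICert K) (s : SData 4 K) (S : Finset (Fin 4)) (j : Fin 4) (b : Fin 4 → K) : Bool :=
  !(equiHB q S j b s) || StepKit.equivB (stepD q S j b s).L [] || ichildInF rest (stepD q S j b s)

/-- The fast F-keyed row check: BLIND, or origin not `q`-fold, or a permissible centre all of whose `K`-rational
replies are harmless. [folklore] -/
def irowHOKF (q : ℕ) (rest : ICert K) (row : IRow K) : Bool :=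
  blindOK q row || !(permB q Finset.univ row.1.L) ||
    (permB q row.2.1 row.1.L &&
      decide (∀ j ∈ row.2.1, ∀ b : Fin 4 → K, b j = 0 → ireplyHOKF q rest row.1 row.2.1 j b = true))

/-- **The fast F-keyed in-scope win-certificate checker with external leaves.** [folklore] -/
def iwinCertHBLF (q : ℕ) (L : List (SData 4 K)) : ICert K → Bool
  | [] => true
  | row :: rest => irowHOKF q (rest ++ leafRows L) row && iwinCertHBLF q L rest

/-! ## 2. Reduction to the F-keyed checker, soundness -/

omit [Fintype K] in
/-- A fast-harmless reply is harmless (F-keyed). [folklore] -/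
theorem ireplyOKF_of_ireplyHOKF {q : ℕ} {rest : ICert K} {s : SData 4 K} {S : Finset (Fin 4)} {j : Fin 4}
    {b : Fin 4 → K} (h : ireplyHOKF q rest s S j b = true) : ireplyOKF q rest s S j b = true := by
  unfold ireplyHOKF at h
  unfold ireplyOKF
  cases hH : equiHB q S j b s with
  | false => rw [equiB_eq_false_of_equiHB hH]; simp
  | true =>
    rw [hH] at h
    simp only [Bool.not_true, Bool.false_or, Bool.or_eq_true] at h
    rcases h with h | h <;> simp [h]

/-- A fast-OK row is OK (F-keyed). [folklore] -/
theorem irowOKF_of_irowHOKF {q : ℕ} {rest : ICert K} {row : IRow K} (h : irowHOKF q rest row = true) :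
    irowOKF q rest row = true := by
  unfold irowHOKF at h
  unfold irowOKF
  simp only [Bool.or_eq_true, Bool.and_eq_true, Bool.not_eq_true', decide_eq_true_eq] at h ⊢
  rcases h with (hb | ht) | ⟨hp, hr⟩
  · exact Or.inl (Or.inl hb)
  · exact Or.inl (Or.inr ht)
  · exact Or.inr ⟨hp, fun j hj b hb => ireplyOKF_of_ireplyHOKF (hr j hj b hb)⟩

/-- **Reduction**: a certificate passing the fast F-keyed checker passes the F-keyed checker. [folklore] -/
theorem iwinCertBLF_of_iwinCertHBLF {q : ℕ} {L : List (SData 4 K)} :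
    ∀ {T : ICert K}, iwinCertHBLF q L T = true → iwinCertBLF q L T = true
  | [], _ => rfl
  | row :: rest, h => by
    simp only [iwinCertHBLF, Bool.and_eq_true] at h
    simp only [iwinCertBLF, Bool.and_eq_true]
    exact ⟨irowOKF_of_irowHOKF h.1, iwinCertBLF_of_iwinCertHBLF h.2⟩

/-- **SOUNDNESS OF THE FAST F-KEYED CHECKER WITH EXTERNAL LEAVES**: if every leaf state is in-scope escapable, so is every
row state of a certificate passing `iwinCertHBLF`. [folklore] -/
theorem inScopeStateWins_of_iwinCertHBLF {q : ℕ} {L : List (SData 4 K)} (hL : ∀ s ∈ L, InScopeStateWins q s.toState)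
    {T : ICert K} (h : iwinCertHBLF q L T = true) : ∀ row ∈ T, InScopeStateWins q row.1.toState :=
  inScopeStateWins_of_iwinCertBLF hL (iwinCertBLF_of_iwinCertHBLF h)

/-- The ROOT of a checked certificate is in-scope escapable. [folklore] -/
theorem inScopeStateWins_head_of_iwinCertHBLF {q : ℕ} {L : List (SData 4 K)}
    (hL : ∀ s ∈ L, InScopeStateWins q s.toState) {row : IRow K} {rest : ICert K}
    (h : iwinCertHBLF q L (row :: rest) = true) : InScopeStateWins q row.1.toState :=
  inScopeStateWins_of_iwinCertHBLF hL h row List.mem_cons_self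

/-! ## 3. Model -/

/-- p-14's PR-12u model certificate `scopeLossCert` (over `𝔽₂`) passes the fast F-keyed checker with no leaves.
[OURS · ‖ K] [folklore] -/
theorem iwinCertHBLF_scopeLossCert : iwinCertHBLF 2 ([] : List (SData 4 (ZMod 2))) scopeLossCert = true := by
  decide +kernel

end InScopeWinCert

end Summit.ResolutionOfSingularities.ResolutionOfSingularities.Theorems.PIDim4

end
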